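import Literature.MathematicalPhysics.QuantumFieldTheory.Balaban1983to89.B9Ineq349SiteFromPinsPairM

/-!
# `Balaban1983to89.B9Ineq349SiteFacesAtLetters` — T. Bałaban, *Propagators for lattice gauge theories in a background field*, Commun. Math. Phys. **99**
# (1985) 389–434 [Balaban1985BackgroundPropagators], (3.49) p. 399 ⇐ Thm 3.1 (3.42) p. 397 + Thm 3.2 (3.48) p. 398: THE ROW-25 KNIT FACE OF THE N06
# CERTIFICATE STATED FOR AN ARBITRARY LETTERS FAMILY `𝔏` WITH def-Y's STANDARD SITE TRANSPORTER AND SITE PROPAGATOR (`(𝔏 x).parS = parSymY`,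
# `(𝔏 x).Gp = GpY … (parSymY …)` — `rfl` at the v4 record AND at any record that re-feeds only the Sect.-D∕E operator fields)

[4] = T. Bałaban, *Propagators and renormalization transformations for lattice gauge theories. II*, Commun. Math. Phys. **96** (1984) 223–250
[`Balaban1984PropagatorsII`].

statement-level skeleton of published theorems with citation tags; proofs where landed; nothing here is a claim about the Yang–Mills mass gap

THE PRINT.  p. 399: *«These theorems [3.1, 3.2] imply all the properties of the operator R … For the operator P = I − R we obtain, using again Lemma 2.1,
(3.49)»*; p. 410: *«Theorem 3.7 implies that all the inequalities (3.42)–(3.47) hold for G′»*; p. 413: *«This theorem [3.9] implies Theorem 3.2»*;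
p. 394–395 (3.24)–(3.25): `G′ = (Δ′_a)⁻¹` symmetric positive.

WHY THIS FILE (dag-n06-i gen 18, N06 bundle F4, row 25).  Edition 20 closes row 25 with gen 15's `B9Ineq349SiteFromPinsPairM.s349_site_lettersYOfRecordV4_of_t37_display348`,
whose conclusion `x ↦ p349SiteY … (lettersYOfRecordV4 … x)` and whose binders `hGpS ∕ h348` NAME the v4 record.  After node00-def-Y's WORD-UNITS-D1
(`Node00.OpsYGpUnits`: the Sect.-D∕E composites are re-fed the print-units site propagator `GpPhysY = η² • GpY`) the certificate's instance moves to a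
letters family `𝔏⁺` whose Sect. A–C fields (`parS`, `Gp`, `GA`, `C`, `P349`) are the v4 ones by `rfl` but which is a different constant; the v4-named face
then fits the knit's `𝔏⁺`-phrased goal only through instance-level definitional unfolding.  The proof underneath is already generic in `𝔏`
(`stmt349Printed_site_of_blockSchemas`, `thm31SiteSchemas_of_left`, `thm31LeftSchema_of_t37_pairM`, `thm32BlkSchema_of_display348`); the ONLY v4-specific
step was the symmetry of `G′(U)` and the `G`-valuedness of the site transporter (`thm31LeftSchemaSymm_lettersYOfRecordV4`).  This file states that step
and the face for any `𝔏` with `(𝔏 x).parS = parSymY x.toKIdx` and `(𝔏 x).Gp = GpY x.toKIdx (parSymY x.toKIdx)` — two `rfl` pins at v4 and at `𝔏⁺`.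

WHAT IS PROVED (sorry-free; bookkeeping over landed objects; `𝔸 = M_N(ℂ)`).
* §1 `thm31LeftSchemaSymm_of_std` (`G ≤ U(N)`): `Thm31LeftSchema c35 𝔏 → Thm31LeftSchemaSymm c35 𝔏` under the two pins (dag-n06-i gen 6
  `isSymmTr_GpY_parSymY` + def-Y `parSymY_mem`).
* §2 `thm31SiteSchemas_of_t37_pairM_of` (`G = SU(N)`): the certificate's `h31S` shape `Thm31SiteSchemas … 𝔏` from row 18's Theorem-3.7 leaf on the
  `PairM` E-letter at the four site pins, for such an `𝔏`.
* §3 ★★★ `s349_site_of_t37_display348_of`: ROW 25 — `B9.Stmt349Printed (d+1) c35 geo9Y bg9Y (x ↦ p349SiteY … x (𝔏 x))` — from row 18's leaf `t37`,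
  rows 15–16's one display `h348` on the faithful one-cube letters over `𝔏`, the faithful block map and the radius-2 count, for such an `𝔏`.

CONSUMER NOTE (dag-n06-d, editions ≥ 21).  At the instance `opsYSectE … (opsYS349NuOfLetters … 𝔏⁺ 𝔈) 𝔏⁺ 𝔢 𝔴` the row-25 goal
`B9.Stmt349Printed … (fun x => (… x).P349)` is `… (fun x => p349SiteY … x (𝔏⁺ x))` by `rfl` (same `𝔏⁺` on both sides), and
`s349 := s349_site_of_t37_display348_of θ' M⋆ 𝔏⁺ (fun _ => rfl) (fun _ => rfl) (trBasis N) hlev hβ1 (hnbr_two_of_le hM₀) 𝔬 rd H hp t37' hblkS hblkYS hGpS hDS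
c35Y_pos hB39.le (hr39.trans_le hrδ39) ha39 hM39 h348` — edition 20's call with `𝔯` replaced by `𝔏⁺ (fun _ => rfl) (fun _ => rfl)`.

HONEST SCOPE.  A bookkeeping generalisation of landed theorems; nothing of [B9] or [4] is asserted; Theorem 3.7's leaf and the (3.48) display remain the
certificate's hypotheses of printed shape where it displays them.  COUNT-NEUTRAL; N06 NOT discharged; one finite 𝕋^{d+1} programme at fixed ε — nothing
continuum, nothing OS, nothing about the mass gap.  Cell `pub-ymgap` (HUMAN RULING D-0062), Track A node N06 [B9], seat `pub-ymgap-dag-n06-i` (gen 18),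
2026-08-27; a NEW file.
-/

noncomputable section

namespace Literature.MathematicalPhysics.QuantumFieldTheory.Balaban1983to89.B9Ineq349SiteFacesAtLetters

open B6GlobalChartV1 (blkV1)
open B6Ineq2142KLevelV1 (lvl β)
open B9Thm37Whole (Ops)
open B9Cor38Whole (WalkReading)
open B9Thm39WholeBlk (Conv348Blk)
open B9Thm39OneCubeReadingAtLettersY (oneCubeOps39YF)
open B9CoReadingCoordsS (XSK blkSK sIK GcoS DcoS)
open B9Ineq349SiteReading (p349SiteY)
open B9Ineq349SiteFromBlocks (Thm31SiteSchemas stmt349Printed_site_of_blockSchemas)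
open B9Ineq349SiteAdjoint (Thm31LeftSchema Thm31LeftSchemaSymm thm31SiteSchemas_of_left isSymmTr_GpY_parSymY)
open B9Ineq349SiteFromPinsPairM (thm31LeftSchema_of_t37_pairM thm32BlkSchema_of_display348)
open B9RWSumsDefinitePins (PinPrims)
open B9RWSumsDefinitePinsPair (PairPrims)
open B9RWSumsDefinitePinsPairM (MixedPrims E37YPairM)
open B7Prop2SpecialUnitary (specialUnitaryUnits specialUnitaryUnits_le_unitaryUnits)
open B9PinMembersKLevelV1 (MemberY geo9Y bg9Y)
open B9RWSumsReadsNbr (nbr)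
open Node00
open scoped Matrix.Norms.L2Operator

variable {d ℓ : ℕ} {hd : 1 ≤ d + 1} {hL : Odd (ℓ + 1) ∧ 1 < ℓ + 1} {b₀ b₁ : ℝ} {Mstar : ℕ} {N : ℕ} {κ : Type} [Fintype κ] [DecidableEq κ]

/-! ## §1 The symmetry and transport conjuncts for ANY letters family with def-Y's standard `parS ∕ Gp` -/

/-- ★ **`Thm31LeftSchema → Thm31LeftSchemaSymm` FOR ANY LETTERS FAMILY WITH THE STANDARD SITE TRANSPORTER AND SITE PROPAGATOR** (`(𝔏 x).parS = parSymY`,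
`(𝔏 x).Gp = GpY … (parSymY …)`; (3.35) gives `U` G-valued; `G ≤ U(N)`): `G′(U) = (Δ′_a(U))⁻¹` over the symmetrised transporters is `trIP`-symmetric
(`isSymmTr_GpY_parSymY`) and `parSymY` is `G`-valued (`parSymY_mem`) — `thm31LeftSchemaSymm_lettersYOfRecordV4` letter-generic.
[cite: Balaban1985BackgroundPropagators, (3.25) p.394, (3.35) p.396, (3.40) p.397] -/
theorem thm31LeftSchemaSymm_of_std {G : Subgroup (Matrix (Fin N) (Fin N) ℂ)ˣ} (hG : G ≤ B7Prop2Explicit.unitaryUnits (Matrix (Fin N) (Fin N) ℂ))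
    (𝔏 : ∀ x : MemberY d ℓ hd hL b₀ b₁ Mstar, CovLettersY (Matrix (Fin N) (Fin N) ℂ) x)
    (hparS : ∀ x : MemberY d ℓ hd hL b₀ b₁ Mstar, (𝔏 x).parS = parSymY x.toKIdx)
    (hGp : ∀ x : MemberY d ℓ hd hL b₀ b₁ Mstar, (𝔏 x).Gp = GpY x.toKIdx (parSymY x.toKIdx)) {c35 : ℝ}
    (h : Thm31LeftSchema (G := G) c35 𝔏) : Thm31LeftSchemaSymm (G := G) c35 𝔏 := by
  obtain ⟨M₁, δ₀, a₀, B₀, hM₁, hδ₀, ha₀, hB₀, H⟩ := h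
  refine ⟨M₁, δ₀, a₀, B₀, hM₁, hδ₀, ha₀, hB₀, fun x hM α₀ hα₀ hMa U hU => ⟨H x hM α₀ hα₀ hMa U hU, ?_, ?_⟩⟩
  · have hUG : ∀ μ y, U μ y ∈ G := hU.1.1
    rw [hGp x]
    exact isSymmTr_GpY_parSymY x.toKIdx hG hUG
  · intro z w
    rw [hparS x]
    exact parSymY_mem x.toKIdx hU.1.1 z w

/-! ## §2 The certificate's `h31S` shape from row 18's leaf, for such an `𝔏` -/

/-- ★ **`Thm31SiteSchemas (M_N(ℂ)) SU(N) c35 𝔏` FROM ROW 18's THEOREM-3.7 LEAF ON THE `PairM` E-LETTER** at the four site pins, the faithful block map and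
the radius-2 count, for any letters family with the standard `parS ∕ Gp` — `thm31SiteSchemas_lettersYOfRecordV4_of_t37_pairM` letter-generic.
[cite: Balaban1985BackgroundPropagators, Thm 3.1 (3.42)–(3.47) p.397–398 ⇐ Thm 3.7 p.410; (3.25) p.394, (3.35) p.396] -/
theorem thm31SiteSchemas_of_t37_pairM_of (θ : Stage3Params) (Mstar : ℕ) (𝔏 : LettersY N θ Mstar)
    (hparS : ∀ x : MemberY θ.d₆ θ.ℓ₆ θ.hd' θ.hL' θ.b₀ θ.b₁ Mstar, (𝔏 x).parS = parSymY x.toKIdx)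
    (hGp : ∀ x : MemberY θ.d₆ θ.ℓ₆ θ.hd' θ.hL' θ.b₀ θ.b₁ Mstar, (𝔏 x).Gp = GpY x.toKIdx (parSymY x.toKIdx))
    [∀ x : MemberY θ.d₆ θ.ℓ₆ θ.hd' θ.hL' θ.b₀ θ.b₁ Mstar, Fintype (geo9Y x).Site] [∀ x : MemberY θ.d₆ θ.ℓ₆ θ.hd' θ.hL' θ.b₀ θ.b₁ Mstar, DecidableEq (geo9Y x).Site]
    (b : Module.Basis κ ℝ (Matrix (Fin N) (Fin N) ℂ)) {c35 : ℝ}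
    {bI : ∀ x : MemberY θ.d₆ θ.ℓ₆ θ.hd' θ.hL' θ.b₀ θ.b₁ Mstar, FBondY x.toKIdx → IBondY x.toKIdx}
    (hlev : ∀ (x : MemberY θ.d₆ θ.ℓ₆ θ.hd' θ.hL' θ.b₀ θ.b₁ Mstar) (f : FBondY x.toKIdx), lvl x.hN x.D x.hk (bI x f) = (blkV1 x.hN x.D f).1.1)
    (hβ1 : ∀ (x : MemberY θ.d₆ θ.ℓ₆ θ.hd' θ.hL' θ.b₀ θ.b₁ Mstar) (f : FBondY x.toKIdx),
      (B6Geom246MultiLevelTorus.geomT x.D).dist (β x.hN x.D x.hk (bI x f)) (blkV1 x.hN x.D f) ≤ 1)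
    {mN : ℕ} (hnbr : ∀ (x : MemberY θ.d₆ θ.ℓ₆ θ.hd' θ.hL' θ.b₀ θ.b₁ Mstar) (y : (geo9Y x).Site), (nbr (geo9Y x) 2 y).card ≤ mN)
    {ι : MemberY θ.d₆ θ.ℓ₆ θ.hd' θ.hL' θ.b₀ θ.b₁ Mstar → Type}
    (𝔬 : ∀ x : MemberY θ.d₆ θ.ℓ₆ θ.hd' θ.hL' θ.b₀ θ.b₁ Mstar, Ops (geo9Y x) (bg9Y (Matrix (Fin N) (Fin N) ℂ) (specialUnitaryUnits (Fin N)) x)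
      (XSK κ x.toKIdx) (XSK κ x.toKIdx) (ι x))
    (rd : ∀ x : MemberY θ.d₆ θ.ℓ₆ θ.hd' θ.hL' θ.b₀ θ.b₁ Mstar, WalkReading (geo9Y x) (bg9Y (Matrix (Fin N) (Fin N) ℂ) (specialUnitaryUnits (Fin N)) x)
      (XSK κ x.toKIdx) (ι x))
    (H : MemberY θ.d₆ θ.ℓ₆ θ.hd' θ.hL' θ.b₀ θ.b₁ Mstar → Prop) {m mN' : ℕ} {Cev NQ : ℝ} {p q : PinPrims} (hp : p.OK) {p3 q3 : PairPrims}
    {pM qM : MixedPrims}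
    {K : ∀ x : MemberY θ.d₆ θ.ℓ₆ θ.hd' θ.hL' θ.b₀ θ.b₁ Mstar, B9.KernelFamily (geo9Y x) (bg9Y (Matrix (Fin N) (Fin N) ℂ) (specialUnitaryUnits (Fin N)) x)}
    (t37 : B9.Thm37Printed c35 (fun x : MemberY θ.d₆ θ.ℓ₆ θ.hd' θ.hL' θ.b₀ θ.b₁ Mstar => geo9Y x)
      (fun x => bg9Y (Matrix (Fin N) (Fin N) ℂ) (specialUnitaryUnits (Fin N)) x)
      (fun x => E37YPairM (bg := bg9Y (Matrix (Fin N) (Fin N) ℂ) (specialUnitaryUnits (Fin N))) m mN' Cev NQ p q p3 q3 pM qM (𝔬 x) (rd x) (H x) (K x)))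
    (hblkS : ∀ x : MemberY θ.d₆ θ.ℓ₆ θ.hd' θ.hL' θ.b₀ θ.b₁ Mstar, (𝔬 x).blk = blkSK x.toKIdx (sIK x.toKIdx (bI x)))
    (hblkYS : ∀ x : MemberY θ.d₆ θ.ℓ₆ θ.hd' θ.hL' θ.b₀ θ.b₁ Mstar, (𝔬 x).blkY = blkSK x.toKIdx (sIK x.toKIdx (bI x)))
    (hGpS : ∀ (x : MemberY θ.d₆ θ.ℓ₆ θ.hd' θ.hL' θ.b₀ θ.b₁ Mstar) (U : (bg9Y (Matrix (Fin N) (Fin N) ℂ) (specialUnitaryUnits (Fin N)) x).Cfg),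
      (𝔬 x).Gp U = GcoS x.toKIdx b (bg9Y (Matrix (Fin N) (Fin N) ℂ) (specialUnitaryUnits (Fin N)) x) (fun U => U) (𝔏 x).Gp U)
    (hDS : ∀ (x : MemberY θ.d₆ θ.ℓ₆ θ.hd' θ.hL' θ.b₀ θ.b₁ Mstar) (U : (bg9Y (Matrix (Fin N) (Fin N) ℂ) (specialUnitaryUnits (Fin N)) x).Cfg),
      (𝔬 x).D U = DcoS x.toKIdx b (bg9Y (Matrix (Fin N) (Fin N) ℂ) (specialUnitaryUnits (Fin N)) x) (fun U => U) U) :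
    Thm31SiteSchemas (Matrix (Fin N) (Fin N) ℂ) (specialUnitaryUnits (Fin N)) c35 𝔏 :=
  thm31SiteSchemas_of_left specialUnitaryUnits_le_unitaryUnits _
    (thm31LeftSchemaSymm_of_std specialUnitaryUnits_le_unitaryUnits 𝔏 hparS hGp
      (thm31LeftSchema_of_t37_pairM specialUnitaryUnits_le_unitaryUnits b 𝔏
        (fun x _ hUG z w => by rw [hparS x]; exact parSymY_mem x.toKIdx hUG z w) hlev hβ1 hnbr 𝔬 rd H hp t37 hblkS hblkYS hGpS hDS))

/-! ## §3 ★★★ Row 25 for such an `𝔏` from `t37` and `h348`: the knit face at the re-fed record -/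

/-- ★★★ **ROW 25 OF THE N06 CERTIFICATE AT ANY LETTERS FAMILY WITH THE STANDARD `parS ∕ Gp`**: (3.49) for the genuine `P = I − R(U)` —
`B9.Stmt349Printed (d+1) c35 geo9Y bg9Y (x ↦ p349SiteY … x (𝔏 x))` (definitionally the certificate's `s349` at the instance over `𝔏`) — from ROW 18's
leaf `t37` on the `PairM` E-letter at the four site pins, ROWS 15–16's one display `h348` (`(3.48)⁻¹` on the faithful one-cube letters over `𝔏`), the
faithful block map (`hlev`, `hβ1`) and the radius-2 count (`hnbr`) — `s349_site_lettersYOfRecordV4_of_t37_display348` with `lettersYOfRecordV4 … 𝔯`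
replaced by `𝔏` and the two `rfl` pins `hparS ∕ hGp`.
[cite: Balaban1985BackgroundPropagators, (3.49) p.399 («using again Lemma 2.1»); Thm 3.1 ⇐ Thm 3.7 p.410; Thm 3.2 ⇐ Thm 3.9 p.413 + (3.96) p.411; (3.25) p.394; Balaban1984PropagatorsII, Lemma 2.1 p.234, (2.51) p.232] -/
theorem s349_site_of_t37_display348_of (θ : Stage3Params) (Mstar : ℕ) (𝔏 : LettersY N θ Mstar)
    (hparS : ∀ x : MemberY θ.d₆ θ.ℓ₆ θ.hd' θ.hL' θ.b₀ θ.b₁ Mstar, (𝔏 x).parS = parSymY x.toKIdx)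
    (hGp : ∀ x : MemberY θ.d₆ θ.ℓ₆ θ.hd' θ.hL' θ.b₀ θ.b₁ Mstar, (𝔏 x).Gp = GpY x.toKIdx (parSymY x.toKIdx))
    [∀ x : MemberY θ.d₆ θ.ℓ₆ θ.hd' θ.hL' θ.b₀ θ.b₁ Mstar, Fintype (geo9Y x).Site] [∀ x : MemberY θ.d₆ θ.ℓ₆ θ.hd' θ.hL' θ.b₀ θ.b₁ Mstar, DecidableEq (geo9Y x).Site]
    (b : Module.Basis κ ℝ (Matrix (Fin N) (Fin N) ℂ)) {c35 : ℝ}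
    {bI : ∀ x : MemberY θ.d₆ θ.ℓ₆ θ.hd' θ.hL' θ.b₀ θ.b₁ Mstar, FBondY x.toKIdx → IBondY x.toKIdx}
    (hlev : ∀ (x : MemberY θ.d₆ θ.ℓ₆ θ.hd' θ.hL' θ.b₀ θ.b₁ Mstar) (f : FBondY x.toKIdx), lvl x.hN x.D x.hk (bI x f) = (blkV1 x.hN x.D f).1.1)
    (hβ1 : ∀ (x : MemberY θ.d₆ θ.ℓ₆ θ.hd' θ.hL' θ.b₀ θ.b₁ Mstar) (f : FBondY x.toKIdx),
      (B6Geom246MultiLevelTorus.geomT x.D).dist (β x.hN x.D x.hk (bI x f)) (blkV1 x.hN x.D f) ≤ 1)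
    {mN : ℕ} (hnbr : ∀ (x : MemberY θ.d₆ θ.ℓ₆ θ.hd' θ.hL' θ.b₀ θ.b₁ Mstar) (y : (geo9Y x).Site), (nbr (geo9Y x) 2 y).card ≤ mN)
    -- row 18: Theorem 3.7's leaf on the `PairM` E-letter at the site pins
    {ι : MemberY θ.d₆ θ.ℓ₆ θ.hd' θ.hL' θ.b₀ θ.b₁ Mstar → Type}
    (𝔬 : ∀ x : MemberY θ.d₆ θ.ℓ₆ θ.hd' θ.hL' θ.b₀ θ.b₁ Mstar, Ops (geo9Y x) (bg9Y (Matrix (Fin N) (Fin N) ℂ) (specialUnitaryUnits (Fin N)) x)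
      (XSK κ x.toKIdx) (XSK κ x.toKIdx) (ι x))
    (rd : ∀ x : MemberY θ.d₆ θ.ℓ₆ θ.hd' θ.hL' θ.b₀ θ.b₁ Mstar, WalkReading (geo9Y x) (bg9Y (Matrix (Fin N) (Fin N) ℂ) (specialUnitaryUnits (Fin N)) x)
      (XSK κ x.toKIdx) (ι x))
    (H : MemberY θ.d₆ θ.ℓ₆ θ.hd' θ.hL' θ.b₀ θ.b₁ Mstar → Prop) {m mN' : ℕ} {Cev NQ : ℝ} {p q : PinPrims} (hp : p.OK) {p3 q3 : PairPrims}
    {pM qM : MixedPrims}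
    {K : ∀ x : MemberY θ.d₆ θ.ℓ₆ θ.hd' θ.hL' θ.b₀ θ.b₁ Mstar, B9.KernelFamily (geo9Y x) (bg9Y (Matrix (Fin N) (Fin N) ℂ) (specialUnitaryUnits (Fin N)) x)}
    (t37 : B9.Thm37Printed c35 (fun x : MemberY θ.d₆ θ.ℓ₆ θ.hd' θ.hL' θ.b₀ θ.b₁ Mstar => geo9Y x)
      (fun x => bg9Y (Matrix (Fin N) (Fin N) ℂ) (specialUnitaryUnits (Fin N)) x)
      (fun x => E37YPairM (bg := bg9Y (Matrix (Fin N) (Fin N) ℂ) (specialUnitaryUnits (Fin N))) m mN' Cev NQ p q p3 q3 pM qM (𝔬 x) (rd x) (H x) (K x)))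
    (hblkS : ∀ x : MemberY θ.d₆ θ.ℓ₆ θ.hd' θ.hL' θ.b₀ θ.b₁ Mstar, (𝔬 x).blk = blkSK x.toKIdx (sIK x.toKIdx (bI x)))
    (hblkYS : ∀ x : MemberY θ.d₆ θ.ℓ₆ θ.hd' θ.hL' θ.b₀ θ.b₁ Mstar, (𝔬 x).blkY = blkSK x.toKIdx (sIK x.toKIdx (bI x)))
    (hGpS : ∀ (x : MemberY θ.d₆ θ.ℓ₆ θ.hd' θ.hL' θ.b₀ θ.b₁ Mstar) (U : (bg9Y (Matrix (Fin N) (Fin N) ℂ) (specialUnitaryUnits (Fin N)) x).Cfg),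
      (𝔬 x).Gp U = GcoS x.toKIdx b (bg9Y (Matrix (Fin N) (Fin N) ℂ) (specialUnitaryUnits (Fin N)) x) (fun U => U) (𝔏 x).Gp U)
    (hDS : ∀ (x : MemberY θ.d₆ θ.ℓ₆ θ.hd' θ.hL' θ.b₀ θ.b₁ Mstar) (U : (bg9Y (Matrix (Fin N) (Fin N) ℂ) (specialUnitaryUnits (Fin N)) x).Cfg),
      (𝔬 x).D U = DcoS x.toKIdx b (bg9Y (Matrix (Fin N) (Fin N) ℂ) (specialUnitaryUnits (Fin N)) x) (fun U => U) U)
    -- rows 15–16: the one display `(3.48)⁻¹` on the faithful one-cube letters over `𝔏`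
    (hc : 0 < c35) {B₁ δ₁ a₁ M₁ : ℝ} (hB : 0 ≤ B₁) (hδ : 0 < δ₁) (ha₁ : 0 < a₁) (hM₁ : 0 < M₁)
    (h348 : ∀ x : MemberY θ.d₆ θ.ℓ₆ θ.hd' θ.hL' θ.b₀ θ.b₁ Mstar, M₁ ≤ (geo9Y x).M → ∀ α₀ : ℝ, 0 < α₀ → c35 * (geo9Y x).M * α₀ ≤ a₁ →
      ∀ U : (bg9Y (Matrix (Fin N) (Fin N) ℂ) (specialUnitaryUnits (Fin N)) x).Cfg,
        (bg9Y (Matrix (Fin N) (Fin N) ℂ) (specialUnitaryUnits (Fin N)) x).Reg335 c35 α₀ U → Conv348Blk (oneCubeOps39YF θ Mstar 𝔏 bI x) B₁ δ₁ U) :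
    B9.Stmt349Printed (θ.d₆ + 1) c35 (geo9Y (d := θ.d₆) (ℓ := θ.ℓ₆) (hd := θ.hd') (hL := θ.hL') (b₀ := θ.b₀) (b₁ := θ.b₁) (Mstar := Mstar))
      (bg9Y (Matrix (Fin N) (Fin N) ℂ) (specialUnitaryUnits (Fin N))) (fun x => p349SiteY (Matrix (Fin N) (Fin N) ℂ) (specialUnitaryUnits (Fin N)) x (𝔏 x)) :=
  stmt349Printed_site_of_blockSchemas 𝔏
    (thm31SiteSchemas_of_t37_pairM_of θ Mstar 𝔏 hparS hGp b hlev hβ1 hnbr 𝔬 rd H hp t37 hblkS hblkYS hGpS hDS)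
    (thm32BlkSchema_of_display348 θ Mstar 𝔏 bI hlev hβ1 hc hB hδ ha₁ hM₁ h348)

end Literature.MathematicalPhysics.QuantumFieldTheory.Balaban1983to89.B9Ineq349SiteFacesAtLetters

end
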